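import Literature.Computability.Cryptography.ChenQuantumLWEDatumValueClosedForm
import Literature.Computability.Cryptography.ChenQuantumLWEJointDatumOptimum

/-!
# The rate of the datum value of Chen's Step-9 register: `V(Q,m) − 1/Q` decays exactly like `minFac(Q)^{−m}` (T13/T14 supplement)

REPRODUCTION / ANALYSIS OF A CLAIMED RESULT UNDER ADJUDICATION (withdrawn): Yilei Chen, *Quantum
Algorithms for Lattice Problems*, IACR ePrint 2024/555, version of 2024-04-18 [ChenQuantumLattice2024]
(the version carrying the author's note that Step 9 contains a bug), Step 9 (§3.5.9, pp. 34–38) and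
the repetition over several runs (§3.6, p. 38).  Bundle `papers/QuantumAdvantage/lwe-quantum-autopsy/`,
Part 2 (`REPAIR-CENSUS.md` §1 theorems **T13/T14**, rows G1/G2, §6 item (4), §22), on top of
`ChenQuantumLWEDatumValueClosedForm.lean` (`datumValue_eq_sum_divisors`:
`V(Q,m) = Q^{-(m+1)}·Σ_{d ∣ Q} φ(Q/d)·d^m`) and `ChenQuantumLWEJointDatumOptimum.lean` (T14: `V(Q,m)` is
the exact optimum of every joint measurement of the Step-9 registers of any number of runs).
HONEST FRAMING: kernel-checked elementary number theory turning the last by-hand sentence of the datum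
census ("the advantage `V − 1/C` is governed by the SMALLEST prime factor of `C`") into two-sided
inequalities — a decidable verdict completing a precise NEGATIVE result about a WITHDRAWN algorithm;
NOT summit progress, no cryptanalytic claim in either direction, no new algorithm for any lattice
problem.

## What is proved (every `Q : ℕ+`, every finite index type `ι`, `m = #ι`, `p = minFac Q`)

* `sum_totient_div_mul_pow_le` / `pow_add_le_sum_totient_div_mul_pow` (in `ℕ`, no division):
  `Q^m·p^m + (p − 1)·Q^m ≤ p^m·Σ_{d ∣ Q} φ(Q/d)·d^m ≤ Q^m·p^m + (Q − 1)·Q^m` — every proper divisor is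
  `≤ Q/p` and the proper divisors carry total weight `Σ φ(Q/d) = Q − 1`; the divisor `Q/p` alone
  carries `φ(p)·(Q/p)^m`.
* **`datumValue_le_minFac`**: `V(Q,m) ≤ 1/Q + (1 − 1/Q)/p^m` — a ceiling for EVERY modulus that needs no
  count of generic patterns; for prime `Q` (`p = Q`) it is T12's exact value.  (By hand, not formalised:
  it never exceeds T10/T11's `1/Q + (1 − 1/Q)·π_B`, `π_B = ((Q − φ(Q))/Q)^m ≥ p^{-m}` for `Q > 1`, with
  equality for prime powers and strict inequality once `Q` has two distinct prime factors, as Chen's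
  `C = p₂p₃⋯p_κ` does.)
* **`datumValue_ge_minFac`**: `1/Q + (p − 1)/(Q·p^m) ≤ V(Q,m)`; for prime `Q` again T12's value, so the
  two bounds COINCIDE exactly on the primes (`datumValue_bracket_of_prime`); **`inv_lt_datumValue`**:
  `1/Q < V(Q,m)` for `Q > 1` (the public read-out of T13 is strictly better than the blind guess, for
  every modulus and every number of unknown coordinates).
* **`datumValue_anti`**: `m ≤ m′ ⇒ V(Q,m′) ≤ V(Q,m)` (more unknown coordinates never help the reader).
* **`tendsto_datumValue`**: for `Q > 1`, `V(Q,m) → 1/Q` as `m → ∞` (squeezed by the two bounds: the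
  register's worth about the datum tends to the blind-guess value at rate exactly `p^{-m}`).
* Steps layer, every admissible shape, `U ∌ 0` the unknown coordinates, `m = #U`:
  **`Shape.datum_privacy_le_minFac`** (every POVM on ONE Step-9 register reads the datum with class
  probability `≤ 1/Q + (1 − 1/Q)/p^m`), **`Shape.joint_datum_privacy_le_minFac`** (the same for every
  JOINT POVM on the registers of any number of runs, T14), **`Shape.datum_privacy_attained_ge_minFac`**
  (T13's public read-out has Born weight `≥ (1/Q + (p−1)/(Q·p^m))·P·N^{n+1} > P·N^{n+1}/Q` on every
  member of the class).

Reading (census rows G1/G2, §6 item (4)): for Chen's `C = p₂p₃⋯p_κ` (odd, square-free, `p = p₂`) and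
`m` unknown coordinates, whatever is measured on the Step-9 registers of however many runs, the
advantage over blind guessing of the datum Step 9 consumes lies in
`[(p₂ − 1)/(C·p₂^m), (1 − 1/C)/p₂^m]` — exponentially small in `m` at the exact rate `p₂^{-m}`, and
useless against T5 at any size.

## What is NOT here

The second-order term (`V − 1/Q − (p−1)/(Q p^m)` is governed by the second-smallest divisor of `Q`
exceeding `1`; not needed by the census); the identification of the class shifts with all
secret-ignorant side information (census §0, by hand); any algorithm.

References: [ChenQuantumLattice2024] as above; [Korobov1992] Ch. I §1 (via the closed form).
-/

namespace Literature.Computability.Cryptography.Chen2024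

open scoped BigOperators Topology
open Filter

/-! ### 1. The divisor sum `Σ_{d ∣ q} φ(q/d)·d^m` against its two leading terms, in `ℕ` -/

section DivisorSum

/-- `φ(q/q) + Σ_{d ∣ q, d ≠ q} φ(q/d) = q`, i.e. the proper divisors carry total weight `q − 1`.
[folklore] -/
theorem one_add_sum_totient_div_erase {q : ℕ} (hq : q ≠ 0) :
    1 + ∑ d ∈ q.divisors.erase q, Nat.totient (q / d) = q := by
  have h := Finset.add_sum_erase q.divisors (fun d => Nat.totient (q / d)) (Nat.mem_divisors_self q hq)
  rw [Nat.div_self (Nat.pos_of_ne_zero hq), Nat.totient_one] at h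
  rw [h, Nat.sum_div_divisors q Nat.totient, Nat.sum_totient]

/-- A proper divisor times the least prime factor does not exceed the number: `d ∣ q`, `d ≠ q` ⇒
`d·minFac(q) ≤ q` (the cofactor `q/d ≥ 2` is a divisor, hence `≥ minFac q`). [folklore] -/
theorem mul_minFac_le_of_mem_divisors_erase {q d : ℕ} (hd : d ∈ q.divisors.erase q) :
    d * q.minFac ≤ q := by
  rcases Finset.mem_erase.1 hd with ⟨hne, hmem⟩
  rcases Nat.mem_divisors.1 hmem with ⟨hdvd, hq⟩
  have hqd : d * (q / d) = q := Nat.mul_div_cancel' hdvd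
  have he2 : 2 ≤ q / d := by
    rcases Nat.lt_or_ge (q / d) 2 with h | h
    · exfalso
      interval_cases hqd' : (q / d)
      · exact hq (by simpa using hqd.symm)
      · exact hne (by simpa using hqd)
    · exact h
  have hmin : q.minFac ≤ q / d := Nat.minFac_le_of_dvd he2 (Nat.div_dvd_of_dvd hdvd)
  calc d * q.minFac ≤ d * (q / d) := Nat.mul_le_mul_left d hmin
    _ = q := hqd

/-- **Upper estimate**: `p^m·Σ_{d ∣ q} φ(q/d)·d^m ≤ q^m·p^m + (q − 1)·q^m`, `p = minFac q` — the divisor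
`q` contributes `q^m p^m`, every other divisor `d` has `(d·p)^m ≤ q^m` and their weights add up to
`q − 1`. [folklore] -/
theorem sum_totient_div_mul_pow_le {q : ℕ} (hq : q ≠ 0) (m : ℕ) :
    (∑ d ∈ q.divisors, Nat.totient (q / d) * d ^ m) * q.minFac ^ m
      ≤ q ^ m * q.minFac ^ m + (q - 1) * q ^ m := by
  rw [Finset.sum_mul, ← Finset.add_sum_erase q.divisors _ (Nat.mem_divisors_self q hq),
    Nat.div_self (Nat.pos_of_ne_zero hq), Nat.totient_one, one_mul]
  refine Nat.add_le_add_left ?_ _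
  have hT : ∑ d ∈ q.divisors.erase q, Nat.totient (q / d) = q - 1 := by
    have := one_add_sum_totient_div_erase hq
    omega
  calc ∑ d ∈ q.divisors.erase q, Nat.totient (q / d) * d ^ m * q.minFac ^ m
      ≤ ∑ d ∈ q.divisors.erase q, Nat.totient (q / d) * q ^ m := by
        refine Finset.sum_le_sum fun d hd => ?_
        rw [mul_assoc, ← mul_pow]
        exact Nat.mul_le_mul_left _ (Nat.pow_le_pow_left (mul_minFac_le_of_mem_divisors_erase hd) m)
    _ = (q - 1) * q ^ m := by rw [← Finset.sum_mul, hT]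

/-- **Lower estimate**: `q^m·p^m + (p − 1)·q^m ≤ p^m·Σ_{d ∣ q} φ(q/d)·d^m`, `p = minFac q` — the
divisors `q` and `q/p` alone (`φ(p) = p − 1`, `(q/p)·p = q`). [folklore] -/
theorem pow_add_le_sum_totient_div_mul_pow {q : ℕ} (hq : q ≠ 0) (m : ℕ) :
    q ^ m * q.minFac ^ m + (q.minFac - 1) * q ^ m
      ≤ (∑ d ∈ q.divisors, Nat.totient (q / d) * d ^ m) * q.minFac ^ m := by
  rw [Finset.sum_mul, ← Finset.add_sum_erase q.divisors _ (Nat.mem_divisors_self q hq),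
    Nat.div_self (Nat.pos_of_ne_zero hq), Nat.totient_one, one_mul]
  refine Nat.add_le_add_left ?_ _
  by_cases h1 : q = 1
  · subst h1
    simp
  · have hp : q.minFac.Prime := Nat.minFac_prime h1
    have hpd : q.minFac ∣ q := Nat.minFac_dvd q
    have hmem : q / q.minFac ∈ q.divisors.erase q := by
      refine Finset.mem_erase.2 ⟨?_, Nat.mem_divisors.2 ⟨Nat.div_dvd_of_dvd hpd, hq⟩⟩
      exact (Nat.div_lt_self (Nat.pos_of_ne_zero hq) hp.one_lt).ne
    have hterm : Nat.totient (q / (q / q.minFac)) * (q / q.minFac) ^ m * q.minFac ^ m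
        = (q.minFac - 1) * q ^ m := by
      rw [Nat.div_div_self hpd hq, Nat.totient_prime hp, mul_assoc, ← mul_pow, Nat.div_mul_cancel hpd]
    rw [← hterm]
    exact Finset.single_le_sum (f := fun d => Nat.totient (q / d) * d ^ m * q.minFac ^ m)
      (fun d _ => Nat.zero_le _) hmem

end DivisorSum

/-! ### 2. The two-sided bound on the value, its monotonicity and its limit -/

section Rate

variable (Q : ℕ+) {ι : Type*} [Fintype ι] [DecidableEq ι]

variable (ι) in
/-- **Upper bound by the least prime factor** (every `Q`): `V(Q,m) ≤ 1/Q + (1 − 1/Q)/p^m`,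
`p = minFac Q`, `m = #ι` — for prime `Q` this is T12's exact value; it never exceeds T10/T11's
`1/Q + (1 − 1/Q)·π_B` (`π_B ≥ p^{-m}`, by hand) and needs no count of generic patterns.
[cite: ChenQuantumLattice2024, §3.5.9 pp. 35–37] -/
theorem datumValue_le_minFac :
    datumValue Q ι ≤ 1 / ((Q : ℕ+) : ℕ)
      + (1 - 1 / ((Q : ℕ+) : ℕ)) / ((((Q : ℕ+) : ℕ).minFac : ℕ) : ℝ) ^ Fintype.card ι := by
  set q : ℕ := ((Q : ℕ+) : ℕ) with hqdef
  set m : ℕ := Fintype.card ι with hmdef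
  have hq : q ≠ 0 := PNat.ne_zero Q
  have hq1 : 1 ≤ q := Nat.one_le_iff_ne_zero.mpr hq
  have hqR : (0 : ℝ) < q := by exact_mod_cast PNat.pos Q
  have hpR : (0 : ℝ) < (q.minFac : ℝ) := by exact_mod_cast Nat.minFac_pos q
  have key : (∑ d ∈ q.divisors, (Nat.totient (q / d) : ℝ) * ((d : ℕ) : ℝ) ^ m) * (q.minFac : ℝ) ^ m
      ≤ (q : ℝ) ^ m * (q.minFac : ℝ) ^ m + ((q : ℝ) - 1) * (q : ℝ) ^ m := by
    have h := sum_totient_div_mul_pow_le hq m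
    have hc : (((∑ d ∈ q.divisors, Nat.totient (q / d) * d ^ m) * q.minFac ^ m : ℕ) : ℝ)
        ≤ ((q ^ m * q.minFac ^ m + (q - 1) * q ^ m : ℕ) : ℝ) := by exact_mod_cast h
    push_cast [Nat.cast_sub hq1] at hc
    exact hc
  rw [datumValue_eq_sum_divisors, div_le_iff₀ (by positivity)]
  rw [← hqdef, ← hmdef]
  have hne : (q.minFac : ℝ) ^ m ≠ 0 := by positivity
  have hqne : (q : ℝ) ≠ 0 := hqR.ne'
  -- multiply the claim by `p^m > 0`
  have hmul : (1 / (q : ℝ) + (1 - 1 / (q : ℝ)) / (q.minFac : ℝ) ^ m) * (q : ℝ) ^ (m + 1)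
      * (q.minFac : ℝ) ^ m = (q : ℝ) ^ m * (q.minFac : ℝ) ^ m + ((q : ℝ) - 1) * (q : ℝ) ^ m := by
    field_simp
    ring
  have := key
  rw [← hmul] at this
  exact le_of_mul_le_mul_right this (by positivity)

variable (ι) in
/-- **Lower bound by the least prime factor** (every `Q`): `1/Q + (p − 1)/(Q·p^m) ≤ V(Q,m)`,
`p = minFac Q` — the divisor `Q/p` alone; for prime `Q` this is again T12's exact value.
[cite: ChenQuantumLattice2024, §3.5.9 pp. 35–37] -/
theorem datumValue_ge_minFac :
    1 / ((Q : ℕ+) : ℕ)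
        + ((((Q : ℕ+) : ℕ).minFac : ℕ) - 1 : ℝ)
          / ((((Q : ℕ+) : ℕ) : ℝ) * ((((Q : ℕ+) : ℕ).minFac : ℕ) : ℝ) ^ Fintype.card ι)
      ≤ datumValue Q ι := by
  set q : ℕ := ((Q : ℕ+) : ℕ) with hqdef
  set m : ℕ := Fintype.card ι with hmdef
  have hq : q ≠ 0 := PNat.ne_zero Q
  have hp1 : 1 ≤ q.minFac := Nat.minFac_pos q
  have hqR : (0 : ℝ) < q := by exact_mod_cast PNat.pos Q
  have hpR : (0 : ℝ) < (q.minFac : ℝ) := by exact_mod_cast Nat.minFac_pos q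
  have key : (q : ℝ) ^ m * (q.minFac : ℝ) ^ m + ((q.minFac : ℝ) - 1) * (q : ℝ) ^ m
      ≤ (∑ d ∈ q.divisors, (Nat.totient (q / d) : ℝ) * ((d : ℕ) : ℝ) ^ m) * (q.minFac : ℝ) ^ m := by
    have h := pow_add_le_sum_totient_div_mul_pow hq m
    have hc : ((q ^ m * q.minFac ^ m + (q.minFac - 1) * q ^ m : ℕ) : ℝ)
        ≤ (((∑ d ∈ q.divisors, Nat.totient (q / d) * d ^ m) * q.minFac ^ m : ℕ) : ℝ) := by
      exact_mod_cast h
    push_cast [Nat.cast_sub hp1] at hc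
    exact hc
  rw [datumValue_eq_sum_divisors, le_div_iff₀ (by positivity)]
  rw [← hqdef, ← hmdef]
  have hmul : (1 / (q : ℝ) + ((q.minFac : ℝ) - 1) / ((q : ℝ) * (q.minFac : ℝ) ^ m)) * (q : ℝ) ^ (m + 1)
      * (q.minFac : ℝ) ^ m = (q : ℝ) ^ m * (q.minFac : ℝ) ^ m + ((q.minFac : ℝ) - 1) * (q : ℝ) ^ m := by
    field_simp
    ring
  have := key
  rw [← hmul] at this
  exact le_of_mul_le_mul_right this (by positivity)

variable (ι) in
/-- **The public read-out beats the blind guess for every modulus**: `1/Q < V(Q,m)` for `Q > 1`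
(`(p − 1)/(Q p^m) > 0`). [cite: ChenQuantumLattice2024, §3.5.9 pp. 35–37] -/
theorem inv_lt_datumValue (hQ : 1 < ((Q : ℕ+) : ℕ)) : 1 / (((Q : ℕ+) : ℕ) : ℝ) < datumValue Q ι := by
  refine lt_of_lt_of_le ?_ (datumValue_ge_minFac Q ι)
  have hqR : (0 : ℝ) < ((Q : ℕ+) : ℕ) := by exact_mod_cast PNat.pos Q
  have hp2 : (2 : ℝ) ≤ ((((Q : ℕ+) : ℕ).minFac : ℕ) : ℝ) := by
    exact_mod_cast (Nat.minFac_prime hQ.ne').two_le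
  have hpos : (0 : ℝ) < ((((Q : ℕ+) : ℕ).minFac : ℕ) - 1 : ℝ)
      / ((((Q : ℕ+) : ℕ) : ℝ) * ((((Q : ℕ+) : ℕ).minFac : ℕ) : ℝ) ^ Fintype.card ι) := by
    apply div_pos
    · linarith
    · positivity
  linarith

/-- For PRIME `Q` the two bounds coincide (and equal T12's value `1/Q + (1 − 1/Q)/Q^m`): the bracket
`[1/Q + (p−1)/(Q p^m), 1/Q + (1 − 1/Q)/p^m]` has width `(Q − p)/(Q p^m)`, zero iff `p = Q`. [folklore] -/
theorem datumValue_bracket_of_prime (hQ : ((Q : ℕ+) : ℕ).Prime) (m : ℕ) :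
    1 / ((Q : ℕ+) : ℕ)
        + ((((Q : ℕ+) : ℕ).minFac : ℕ) - 1 : ℝ)
          / ((((Q : ℕ+) : ℕ) : ℝ) * ((((Q : ℕ+) : ℕ).minFac : ℕ) : ℝ) ^ m)
      = 1 / ((Q : ℕ+) : ℕ)
        + (1 - 1 / ((Q : ℕ+) : ℕ)) / ((((Q : ℕ+) : ℕ).minFac : ℕ) : ℝ) ^ m := by
  rw [hQ.minFac_eq]
  have hqR : (((Q : ℕ+) : ℕ) : ℝ) ≠ 0 := by exact_mod_cast PNat.ne_zero Q
  field_simp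

/-- **More unknown coordinates never help**: `#ι ≤ #ι′ ⇒ V(Q, ι′) ≤ V(Q, ι)` (`(d/Q)^m` is
non-increasing in `m` for every divisor `d ≤ Q`). [cite: ChenQuantumLattice2024, §3.5.9 pp. 35–37] -/
theorem datumValue_anti {ι' : Type*} [Fintype ι'] [DecidableEq ι']
    (h : Fintype.card ι ≤ Fintype.card ι') : datumValue Q ι' ≤ datumValue Q ι := by
  set q : ℕ := ((Q : ℕ+) : ℕ) with hqdef
  have hq : q ≠ 0 := PNat.ne_zero Q
  have hqR : (0 : ℝ) < q := by exact_mod_cast PNat.pos Q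
  obtain ⟨k, hk⟩ := Nat.exists_eq_add_of_le h
  rw [datumValue_eq_sum_divisors, datumValue_eq_sum_divisors, ← hqdef, hk, Finset.sum_div,
    Finset.sum_div]
  refine Finset.sum_le_sum fun d hd => ?_
  have hdq : d ≤ q := Nat.divisor_le hd
  rw [mul_div_assoc, mul_div_assoc]
  refine mul_le_mul_of_nonneg_left ?_ (Nat.cast_nonneg _)
  rw [div_le_div_iff₀ (by positivity) (by positivity)]
  have hnat : d ^ (Fintype.card ι + k) * q ^ (Fintype.card ι + 1)
      ≤ d ^ Fintype.card ι * q ^ (Fintype.card ι + k + 1) := by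
    have : d ^ k ≤ q ^ k := Nat.pow_le_pow_left hdq k
    calc d ^ (Fintype.card ι + k) * q ^ (Fintype.card ι + 1)
        = d ^ Fintype.card ι * q ^ (Fintype.card ι + 1) * d ^ k := by ring
      _ ≤ d ^ Fintype.card ι * q ^ (Fintype.card ι + 1) * q ^ k := Nat.mul_le_mul_left _ this
      _ = d ^ Fintype.card ι * q ^ (Fintype.card ι + k + 1) := by ring
  exact_mod_cast hnat

/-- **The limit**: for `Q > 1`, `V(Q,m) → 1/Q` as the number `m` of unknown coordinates grows — squeezed
between `1/Q + (p−1)/(Q p^m)` and `1/Q + (1 − 1/Q)/p^m`, `p = minFac Q ≥ 2`.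
[cite: ChenQuantumLattice2024, §3.5.9 pp. 35–37] -/
theorem tendsto_datumValue (hQ : 1 < ((Q : ℕ+) : ℕ)) :
    Tendsto (fun m : ℕ => datumValue Q (Fin m)) atTop (𝓝 (1 / (((Q : ℕ+) : ℕ) : ℝ))) := by
  set q : ℕ := ((Q : ℕ+) : ℕ) with hqdef
  have hqR : (0 : ℝ) < q := by exact_mod_cast PNat.pos Q
  have hp2 : (2 : ℝ) ≤ (q.minFac : ℝ) := by exact_mod_cast (Nat.minFac_prime hQ.ne').two_le
  have hpR : (0 : ℝ) < (q.minFac : ℝ) := by linarith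
  -- the upper envelope `1/q + (1 − 1/q)·(1/p)^m → 1/q`
  have hr0 : (0 : ℝ) ≤ 1 / (q.minFac : ℝ) := by positivity
  have hr1 : 1 / (q.minFac : ℝ) < 1 := by
    rw [div_lt_one hpR]
    linarith
  have hgeom := tendsto_pow_atTop_nhds_zero_of_lt_one hr0 hr1
  have hup : Tendsto (fun m : ℕ => 1 / (q : ℝ) + (1 - 1 / (q : ℝ)) * (1 / (q.minFac : ℝ)) ^ m) atTop
      (𝓝 (1 / (q : ℝ))) := by
    have := (tendsto_const_nhds (x := 1 - 1 / (q : ℝ))).mul hgeom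
    rw [mul_zero] at this
    simpa using (tendsto_const_nhds (x := 1 / (q : ℝ))).add this
  refine tendsto_of_tendsto_of_tendsto_of_le_of_le tendsto_const_nhds hup (fun m => ?_) (fun m => ?_)
  · -- lower: `1/q ≤ V`
    have h := datumValue_ge_minFac Q (Fin m)
    have hnn : (0 : ℝ) ≤ ((q.minFac : ℕ) - 1 : ℝ) / ((q : ℝ) * (q.minFac : ℝ) ^ Fintype.card (Fin m)) := by
      apply div_nonneg
      · linarith
      · positivity
    simp only [← hqdef] at h ⊢
    linarith
  · -- upper
    have h := datumValue_le_minFac Q (Fin m)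
    simp only [← hqdef, Fintype.card_fin] at h ⊢
    rw [one_div_pow, ← div_eq_mul_one_div]
    exact h

end Rate

end Literature.Computability.Cryptography.Chen2024

/-! ### 3. Steps layer: the `π`-free ceilings for every admissible shape -/

namespace Literature.Computability.Cryptography.Chen2024.Shape

open scoped BigOperators ComplexOrder
open Matrix

variable (S : Shape)

/-- **Every measurement of ONE Step-9 register, every modulus** (T13 + the rate bound): with `U ∌ 0`
the unknown coordinates (`m = #U`) and `bk` public as in T12/T13, every POVM reads the datum with class
success probability at most `1/Q + (1 − 1/Q)/minFac(Q)^m` — no count of generic patterns needed (for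
Chen's `Q = p₂p₃⋯p_κ`, with at least two distinct prime factors, strictly below T10's
`1/Q + (1 − 1/Q)·π_B`; by hand).
[cite: ChenQuantumLattice2024, §3.5.9 pp. 35–38, eq. (12) p. 17, Cond. C.3–C.5 p. 18] -/
theorem datum_privacy_le_minFac (h : S.Admissible) (U : Finset (Fin (S.n + 1)))
    (hU : (0 : Fin (S.n + 1)) ∉ U) (bk : Fin (S.n + 1) → ℤ)
    (hbkU : ∀ i ∈ U, ((S.p₁ : ℕ) : ℤ) ∣ bk i) (hbk : ∀ i, i ∉ U → bk i = S.b i)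
    (v' : Fin (S.n + 1) → ℤ) (E : POVM (Fin (S.n + 1) → ZN S.D S.p₁ S.Q) (ZQ S.Q)) :
    (∑ a, ∑ sc, E.weight (datumKet S.n S.D S.p₁ S.Q U bk S.b v' a sc) a).re
        / (∑ a : ZQ S.Q, ∑ sc, star (datumKet S.n S.D S.p₁ S.Q U bk S.b v' a sc)
            ⬝ᵥ datumKet S.n S.D S.p₁ S.Q U bk S.b v' a sc).re
      ≤ 1 / (S.Q : ℕ) + (1 - 1 / (S.Q : ℕ)) / (((S.Q : ℕ).minFac : ℕ) : ℝ) ^ U.card := by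
  have h1 := (S.datum_privacy_optimum h U hU bk hbkU hbk v').2 ⟨E, rfl⟩
  have h2 := datumValue_le_minFac S.Q (U : Type)
  rw [Fintype.card_coe] at h2
  exact h1.trans h2

variable {κ : Type*} [Fintype κ] [DecidableEq κ]

/-- **Every JOINT measurement of the Step-9 registers of any number of runs, every modulus** (T14 + the
rate bound): the joint-class success probability for run `0`'s datum is at most
`1/Q + (1 − 1/Q)/minFac(Q)^m` — the several-runs ceiling of census §6 item (4) in closed form.
[cite: ChenQuantumLattice2024, §3.5.9 pp. 35–38, §3.6 p. 38, Cond. C.3–C.5 p. 18] -/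
theorem joint_datum_privacy_le_minFac (h : S.Admissible) (U : Finset (Fin (S.n + 1)))
    (hU : (0 : Fin (S.n + 1)) ∉ U) (bk : Fin (S.n + 1) → ℤ)
    (hbkU : ∀ i ∈ U, ((S.p₁ : ℕ) : ℤ) ∣ bk i) (hbk : ∀ i, i ∉ U → bk i = S.b i)
    (v' : Fin (S.n + 1) → ℤ) (w : κ → Fin (S.n + 1) → ℤ)
    (E : POVM ((Fin (S.n + 1) → ZN S.D S.p₁ S.Q) × (κ → (Fin (S.n + 1) → ZN S.D S.p₁ S.Q))) (ZQ S.Q)) :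
    (∑ a, ∑ i, E.weight (jointDatumKet S.n S.D S.p₁ S.Q U bk S.b v' w a i) a).re
        / (∑ a : ZQ S.Q, ∑ i, star (jointDatumKet S.n S.D S.p₁ S.Q U bk S.b v' w a i)
            ⬝ᵥ jointDatumKet S.n S.D S.p₁ S.Q U bk S.b v' w a i).re
      ≤ 1 / (S.Q : ℕ) + (1 - 1 / (S.Q : ℕ)) / (((S.Q : ℕ).minFac : ℕ) : ℝ) ^ U.card := by
  have h1 := (S.joint_datum_privacy_optimum h U hU bk hbkU hbk v' w).2 ⟨E, rfl⟩
  have h2 := datumValue_le_minFac S.Q (U : Type)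
  rw [Fintype.card_coe] at h2
  exact h1.trans h2

/-- **The public read-out's guaranteed advantage, every modulus**: on EVERY member of the class T13's
general datum read-out outputs the datum with Born weight at least
`(1/Q + (minFac(Q) − 1)/(Q·minFac(Q)^m))·P·N^{n+1}`, strictly more than the blind guess's `P·N^{n+1}/Q`
(`Q ≥ 3` for admissible shapes). [cite: ChenQuantumLattice2024, §3.5.9 pp. 35–38, Cond. C.3–C.5 p. 18] -/
theorem datum_privacy_attained_ge_minFac (h : S.Admissible) (U : Finset (Fin (S.n + 1)))
    (hU : (0 : Fin (S.n + 1)) ∉ U) (bk : Fin (S.n + 1) → ℤ)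
    (hbkU : ∀ i ∈ U, ((S.p₁ : ℕ) : ℤ) ∣ bk i) (hbk : ∀ i, i ∉ U → bk i = S.b i)
    (v' : Fin (S.n + 1) → ℤ) (a : ZQ S.Q) (sc : (Fin (S.n + 1) → ZQ S.Q) × (Fin (S.n + 1) → ZQ S.Q)) :
    (1 / (S.Q : ℕ) + ((((S.Q : ℕ).minFac : ℕ) - 1 : ℝ)) / (((S.Q : ℕ) : ℝ) * (((S.Q : ℕ).minFac : ℕ) : ℝ) ^ U.card))
        * (((S.P : ℕ) : ℝ) * ((S.N : ℕ) : ℝ) ^ (S.n + 1))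
      ≤ ((datumReadoutGen S.n S.D S.p₁ S.Q h.odd_P U bk v' (h.exists_unit_coord hU hbk)).weight
          (datumKet S.n S.D S.p₁ S.Q U bk S.b v' a sc) a).re := by
  rw [S.datum_privacy_optimum_attained h U hU bk hbkU hbk v' a sc, Complex.ofReal_re]
  have h2 := datumValue_ge_minFac S.Q (U : Type)
  rw [Fintype.card_coe] at h2
  exact mul_le_mul_of_nonneg_right h2 (by positivity)

end Literature.Computability.Cryptography.Chen2024.Shape
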